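import Literature.Analysis.FluidPDE.EyinkLocalFourFifths
import Literature.Analysis.FluidPDE.DuchonRobertInviscidLimit
import HarnessLib

/-!
# Novack's unconditional local 4/3, 4/5 and 8/15 laws (Novack 2024, Thm. 1)

Topic: Analysis/FluidPDE, companion to `Literature.Analysis.FluidPDE.DissipationAnomaly`
(the predicates `Torus.HasFourThirdsLaw`, `Torus.HasFourFifthsLaw`, the Duchon–Robert defect
`Torus.HasDuchonRobertDefect`, the local energy balance `Torus.HasLocalEnergyBalance`) and to
`Literature.Analysis.FluidPDE.EyinkLocalFourFifths` (Eyink 2003, Thm. 1 and Cor. 1 as printed).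

## Why this file exists (a second discrepancy record, and its resolution in the literature)

The accepted facts `Torus.HasDuchonRobertDefect.hasFourFifthsLaw`,
`Torus.HasDuchonRobertDefect.hasFourThirdsLaw` (`DissipationAnomaly`) and
`FluidPDE.eyink_local_four_fifths` (`DuchonRobert`) assert that for **every** weak Euler
solution `u ∈ L³((0,T) × T^d)` with Duchon–Robert defect `D` the shell limits
`lim_{ℓ→0⁺} ℓ⁻¹ ⨍ (δ_L u(ℓω))³ dω = −(12/(d(d+2))) D` and
`lim_{ℓ→0⁺} ℓ⁻¹ ⨍ δ_L u |δu|²(ℓω) dω = −(4/d) D` **exist**, citing Eyink 2003 / Duchon–Robert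
2000. Those sources prove the identification of the limits *assuming they exist*
(Eyink 2003, Cor. 1: "Assume that the functions `S_L(u,ℓ), S_T(u,ℓ)` … have limits … Then
`S_L(u) = −4/5 D(u)`, `S_T(u) = −8/15 D(u)`"; §1 for the 4/3 law), which is what
`EyinkLocalFourFifths` records and proves (`HasDuchonRobertDefect.hasFourFifthsLaw_of_limits`,
`hasFourThirdsLaw_of_limit`).

The **unconditional** statement is nevertheless a published theorem, twenty years younger:
M. Novack, *Scaling laws and exact results in turbulence*, Nonlinearity 37 (2024) 095002
(arXiv:2310.01375), Thm. 1 ("our contribution is to remove the conditionality on the existence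
of the limit", op. cit. §1), proved by running the Duchon–Robert balance with mollifiers whose
gradients concentrate on the sphere `|y| = ℓ` (limit `γ → 0`, a ball kernel) and then `ℓ → 0`.
It is printed on `T^d`, `d ≥ 2`, for weak solutions `(u, p)` of the pressure-explicit weak
formulation with datum (op. cit. §1, the integral equality preceding Thm. 1, where for `ν = 0`
"we only require `u ∈ C⁰([0,T]; L²(T^d))`"), under `u ∈ L³([0,T] × T^d) ∩ C⁰([0,T]; L²(T^d))`,
`u₀ ∈ L²`. This file vendors that theorem (Euler case `ν = 0`, unforced `f = 0`) as named facts
and derives from it the **corrected forms** of the two misstated facts: the unconditional local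
laws hold for Duchon–Robert defects of weak Euler solutions that are, in addition to `L³`,
*continuous in time with values in `L²`* — the one standing hypothesis of the source that the
older facts omit — in dimension `d ≥ 2`.

## Contents

* `Torus.IsWeakEulerSolutionWithPressureOn T f u₀ u p` — Novack's weak formulation (op. cit. §1,
  p. 4, `ν = 0`): for **every** smooth vector field `φ` on `ℝ × T^d` (no support condition),
  `∫₀ᵀ∫ (⟪u, ∂ₜφ⟫ + ⟪u, (u·∇)φ⟫ + p div φ + ⟪f, φ⟫) + ∫ ⟪u₀, φ(0)⟫ − ∫ ⟪u(T), φ(T)⟫ = 0`, with the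
  measurability / `u ∈ L²_{t,x}` / `p ∈ L¹_{t,x}` / weak incompressibility bookkeeping of the
  accepted `Torus.IsDistributionalNSSolutionOn`; bridges `.isDistributionalNSSolutionOn`
  (restrict to tests supported in `(0,T)`), `.isWeakNSSolutionForcedOn` (divergence-free tests
  on `[0,T)`), `.isWeakEulerSolutionOn`.
* **Named facts** (Novack 2024, Thm. 1, `ν = 0`, `f = 0`): `Torus.novack2024_fourThirds_fourFifths`
  (the lines `• = I, L`: `HasFourThirdsLaw T u D ∧ HasFourFifthsLaw T u D` for every `D`
  satisfying the local energy balance `HasLocalEnergyBalance T 0 u p G D`) and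
  `Torus.novack2024_transverseLaw` (the line `• = T`:
  `ℓ⁻¹ ⨍ δ_L u |δu_T|² → −(4(d−1)/(d(d+2))) D`, i.e. `−8/15 D` for `d = 3`, with the accepted
  `Torus.mixedFluxSphereAvg` of `EyinkLocalFourFifths`).
* **Corrected statements, proved from the facts**:
  `Torus.HasDuchonRobertDefect.hasFourFifthsLaw_of_continuousInLp` and
  `Torus.HasDuchonRobertDefect.hasFourThirdsLaw_of_continuousInLp` — for `d ≥ 2`, `0 < T`,
  `(u, p)` a weak Euler solution in Novack's sense with `u ∈ L³ ∩ C⁰_t L²_x`, `p ∈ L^{3/2}`,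
  `u₀ ∈ L²`, and `D` **any** Duchon–Robert defect of `u` (`HasDuchonRobertDefect T u D`, the
  hypothesis of the misstated facts), `HasFourFifthsLaw T u D` and `HasFourThirdsLaw T u D`; the
  identification of `D` with the energy-balance defect is Duchon–Robert 2000, Prop. 2, threaded
  as the accepted named fact `FluidPDE.duchon_robert_defect_exists`; and
  `Torus.HasDuchonRobertDefect.tendsto_mixedFlux_of_continuousInLp` (the `8/15`-type law).

## Design notes

* The weak formulation is written with all terms on one side of a single space–time integral
  (`… + ∫ ⟪u₀, φ 0⟫ − ∫ ⟪u T, φ T⟫ = 0`), the tree's convention (`IsWeakNSSolutionForcedOn`);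
  Novack prints `∫ [φ(0)·u₀ − φ(T)·u(T)] + ∫∫ φ·f = −∫∫ [∂ₜφ·u + ∂ⱼφⁱ uⁱ uʲ + p ∂ᵢφⁱ]`, the same
  equation. **Sign disclosure:** the arXiv display prints the bracket as
  `[(∂ₜφⁱuⁱ) − (∂ⱼφⁱuⁱuʲ) − (∂ᵢφⁱ p) + ν(∂ⱼφⁱ∂ⱼuⁱ)]`, i.e. with the convective, pressure and
  viscous terms carrying the opposite relative sign to the time term — a typo: for a smooth
  solution of `∂ₜu + div(u ⊗ u) + ∇p = νΔu + f` integration by parts gives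
  `[∂ₜφ·u + ∂ⱼφⁱuⁱuʲ + p div φ − ν∇φ:∇u]`, and the printed form would force the nonlinear and
  pressure integrals to vanish. The signs used here are the ones Novack's derivation (§2) uses
  and coincide with the accepted interior notion `Torus.IsDistributionalNSSolutionOn`
  (Caffarelli–Kohn–Nirenberg (2.1)–(2.2)), as the proved bridge shows. So the definition is
  Novack's *verbatim up to that sign typo*.
* Test fields are `φ : ℝ → T^d → ℝ^d` with `C^∞` space–time lift on all of `ℝ × ℝ^d`; every
  smooth field on `[0,T] × T^d` extends to one (Seeley/Whitney extension), so quantifying over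
  globally smooth `φ` is Novack's "for all `φⁱ ∈ C^∞([0,T] × T^d)`".
* The time continuity `u ∈ C⁰([0,T]; L²)` of Novack's definition is kept as the separate
  hypothesis `Torus.ContinuousInLpOn (Icc 0 T) 2 u` of the facts (it is what gives the slice
  `u T` in the endpoint term its meaning); `p ∈ L^{3/2}_{t,x}` is the integrability of the
  pressure that the printed proof uses ("using the integrability assumptions on `u` and `p`",
  §2) and that Duchon–Robert's Prop. 2 assumes — making it explicit does not strengthen the fact.
* In the tree's halved balance `HasLocalEnergyBalance T 0 u p G D`
  (`∫∫ ½|u|²∂ₜψ + (½|u|² + p)⟪u,∇ψ⟫ = D ψ`, Duchon–Robert (10)) the functional `D` is Novack's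
  `D_•` (his balance reads `∂ₜ|u|² + ∂ⱼ(uʲ|u|² + 2puʲ) = −2D_•`); with `ν = 0` the gradient
  witness `G` is irrelevant (its term is literally `0 · _`), whence the `∀ G`. Novack *defines*
  `D_I, D_L, D_T` by the three shell limits and proves the balance for each; since the balance
  determines `D ψ` on test functions, "for every `D` with the balance, the three laws hold with
  `D`" is the same statement (and `D_I = D_L = D_T`).
* Constants: `Torus.fourThirdsConst d = 4/d`, `Torus.fourFifthsConst d = 12/(d(d+2))` and
  `4(d−1)/(d(d+2))` are exactly Novack's (1.6a–c) (`|T_I δu|² = |δu|²`, `|T_L δu|² = (ŷ·δu)²`,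
  `T_T δu = δu − (ŷ·δu)ŷ` for unit `ŷ`; `⨍` is the sphere *average*, as his normalisations
  `S_I = (d/4)∫⨍…` confirm); `Torus.increment u (ℓ•ω) x = u(x + ℓω) − u(x)` is his
  `u(t,x+ℓy) − u(t,x)`.
* Not vendored here: the viscous/forced cases of Thm. 1, Cor. 1 (laws in the inviscid limit over
  `ℓ ∈ [ℓ_D, ℓ_I]`), and the converse bridge from the tree's pressure-free
  `Torus.IsWeakEulerSolutionOn` (it needs the Calderón–Zygmund pressure,
  `Torus.exists_pressure_of_tendsto_L3`, and a routine time-cutoff argument).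

## Mathlib search

Mathlib (this pin) has no weak Euler/Navier–Stokes solution notions, structure functions or
Kolmogorov laws (searched `Kolmogorov`, `structureFunction`, `Euler` + `weak`: unrelated hits
only); everything builds on the accepted Literature notions listed above.

## References

* M. Novack, *Scaling laws and exact results in turbulence*, Nonlinearity 37 (2024), no. 9,
  095002, doi:10.1088/1361-6544/ad6057, arXiv:2310.01375: §1 (weak formulation, p. 4; Thm. 1
  "Energy balance identities", (1.5)–(1.6a–c); Remark 1 "Numerology"), §2 (proof: Step 0 test
  function computations, Step 1 `• = I` with the ball kernel `γ = 0`, Step 2 `• = L, T`).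
  [Novack2024]
* G. L. Eyink, *Local 4/5-law and energy dissipation anomaly in turbulence*, Nonlinearity 16
  (2003) 137–145, §2 Thm. 1, Cor. 1 (the conditional laws). [Eyink2003]
* J. Duchon, R. Robert, *Inertial energy dissipation for weak solutions of incompressible Euler
  and Navier–Stokes equations*, Nonlinearity 13 (2000) 249–255, Prop. 2 (defect and local
  balance for `L³` weak Euler solutions). [DuchonRobert2000]
-/

noncomputable section

open MeasureTheory TopologicalSpace Set Function Filter Topology Metric
open scoped InnerProductSpace RealInnerProductSpace ENNReal NNReal

namespace Literature.Analysis.FluidPDE.Torus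

variable {d : Type*} [Fintype d]

/-! ## Novack's weak formulation (pressure-explicit, with datum) -/

section WeakForm

variable [DecidableEq d]

/-- **Weak solutions of incompressible Euler in Novack's sense** on `T^d × [0, T]` (Novack 2024,
§1, p. 4, the integral equality defining weak solutions, case `ν = 0`): `u`, `p` are
a.e.-strongly measurable on `(0,T) × T^d`, `u ∈ L²_{t,x}`, `p ∈ L¹_{t,x}`, `u(t)` is weakly
divergence free for a.e. `t ∈ (0,T)` (the same bookkeeping as the accepted
`Torus.IsDistributionalNSSolutionOn`), and for **every** smooth vector field `φ` on `ℝ × T^d`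
(smooth space–time lift, no support condition — "for all `φⁱ ∈ C^∞([0,T] × T^d)`")
`∫₀ᵀ∫ (⟪u, ∂ₜφ⟫ + ⟪u, (u·∇)φ⟫ + p div φ + ⟪f, φ⟫) dx dt + ∫ ⟪u₀, φ(0)⟫ dx − ∫ ⟪u(T), φ(T)⟫ dx = 0`,
Novack's `∫ [φ(0)·u₀ − φ(T)·u(T)] + ∫∫ φ·f = −∫∫ [∂ₜφ·u + ∂ⱼφⁱuⁱuʲ + p ∂ᵢφⁱ]` with all terms
on one side. **Discrepancy (sign typo in the source):** the arXiv display prints the last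
bracket as `[(∂ₜφⁱuⁱ) − (∂ⱼφⁱuⁱuʲ) − (∂ᵢφⁱp) + ν(∂ⱼφⁱ∂ⱼuⁱ)]`; for a smooth solution of
`∂ₜu + div(u ⊗ u) + ∇p = νΔu + f` the bracket must read `[∂ₜφ·u + ∂ⱼφⁱuⁱuʲ + p div φ − ν∇φ:∇u]`
(the printed signs would force the nonlinear and pressure integrals to vanish), and these are
the signs of Novack's §2 and of `Torus.IsDistributionalNSSolutionOn` (CKN (2.1)–(2.2)), see
`IsWeakEulerSolutionWithPressureOn.isDistributionalNSSolutionOn`. Novack's standing requirement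
`u ∈ C⁰([0,T]; L²(T^d))` (which gives the slice `u T` its meaning) is imposed separately where
used (`Torus.ContinuousInLpOn (Icc 0 T) 2 u`). [cite: Novack2024, Sect. 1 p. 4 weak formulation preceding Thm. 1] -/
def IsWeakEulerSolutionWithPressureOn (T : ℝ) (f : ℝ → UnitAddTorus d → EuclideanSpace ℝ d)
    (u₀ : UnitAddTorus d → EuclideanSpace ℝ d) (u : ℝ → UnitAddTorus d → EuclideanSpace ℝ d)
    (p : ℝ → UnitAddTorus d → ℝ) : Prop :=
  AEStronglyMeasurable (FunctionSpaces.Torus.stLift u) (volume.restrict (Ioo 0 T ×ˢ univ)) ∧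
    (∫⁻ t in Ioo 0 T, ∫⁻ x, ‖u t x‖ₑ ^ 2 < ∞) ∧
    AEStronglyMeasurable (FunctionSpaces.Torus.stLift p) (volume.restrict (Ioo 0 T ×ˢ univ)) ∧
    (∫⁻ t in Ioo 0 T, ∫⁻ x, ‖p t x‖ₑ < ∞) ∧
    (∀ᵐ t ∂(volume.restrict (Ioo 0 T)), FunctionSpaces.Torus.IsWeaklyDivFree (u t)) ∧
    ∀ φ : ℝ → UnitAddTorus d → EuclideanSpace ℝ d,
      ContDiff ℝ ((⊤ : ℕ∞) : WithTop ℕ∞) (FunctionSpaces.Torus.stLift φ) →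
      (∫ t in Ioo 0 T, ∫ x, (⟪u t x, FunctionSpaces.Torus.timeDeriv φ t x⟫ +
          ⟪u t x, FunctionSpaces.Torus.convect (u t) (φ t) x⟫ +
          p t x * FunctionSpaces.Torus.divergence (φ t) x + ⟪f t x, φ t x⟫)) +
        (∫ x, ⟪u₀ x, φ 0 x⟫) - ∫ x, ⟪u T x, φ T x⟫ = 0

variable {T : ℝ} {f u : ℝ → UnitAddTorus d → EuclideanSpace ℝ d}
  {u₀ : UnitAddTorus d → EuclideanSpace ℝ d} {p : ℝ → UnitAddTorus d → ℝ}

omit [DecidableEq d] in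
/-- A space–time test field on `[0, T)` vanishes at the final time `t = T` (it vanishes for
`t ≥ T'`, some `T' < T`). [folklore] -/
theorem _root_.Literature.Analysis.FunctionSpaces.Torus.IsSpaceTimeTest.apply_self
    {F : Type*} [NormedAddCommGroup F] [NormedSpace ℝ F] {ψ : ℝ → UnitAddTorus d → F}
    (hψ : FunctionSpaces.Torus.IsSpaceTimeTest T ψ) : ψ T = 0 := by
  obtain ⟨T', hT', h⟩ := hψ.2
  exact h T hT'.le

/-- **Novack's weak solutions are distributional solutions on the open time interval**: against
vector tests compactly supported in `(0, T)` both endpoint terms vanish and Novack's identity is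
the identity of the accepted `Torus.IsDistributionalNSSolutionOn T 0 f u p`
(Caffarelli–Kohn–Nirenberg (2.1)–(2.2) on the torus) — this is the sign check of the definition. [cite: Novack2024, Sect. 1 p. 4 weak formulation preceding Thm. 1] -/
theorem IsWeakEulerSolutionWithPressureOn.isDistributionalNSSolutionOn
    (h : IsWeakEulerSolutionWithPressureOn T f u₀ u p) : IsDistributionalNSSolutionOn T 0 f u p := by
  refine ⟨h.1, h.2.1, h.2.2.1, h.2.2.2.1, h.2.2.2.2.1, fun ψ hψ => ?_⟩
  have hid := h.2.2.2.2.2 ψ hψ.1.1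
  rw [hψ.apply_zero, hψ.1.apply_self] at hid
  simpa only [Pi.zero_apply, inner_zero_right, integral_zero, add_zero, sub_zero, zero_mul]
    using hid

/-- **Novack's weak solutions are weak solutions with datum** in the pressure-free sense of the
tree (`IsWeakNSSolutionForcedOn T 0 f u₀ u`; Temam, Ch. III (1.22)–(1.23)): against
divergence-free tests on `[0, T)` the pressure term and the endpoint term at `T` drop out. [cite: Novack2024, Sect. 1 p. 4 weak formulation preceding Thm. 1] -/
theorem IsWeakEulerSolutionWithPressureOn.isWeakNSSolutionForcedOn
    (h : IsWeakEulerSolutionWithPressureOn T f u₀ u p) : IsWeakNSSolutionForcedOn T 0 f u₀ u := by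
  refine ⟨h.1, h.2.1, h.2.2.2.2.1, fun ψ hψ hdiv => ?_⟩
  have hid := h.2.2.2.2.2 ψ hψ.1
  rw [hψ.apply_self] at hid
  have hdiv' : ∀ t x, FunctionSpaces.Torus.divergence (ψ t) x = 0 := fun t x => hdiv t x
  simpa only [Pi.zero_apply, inner_zero_right, integral_zero, sub_zero, zero_mul, add_zero,
    hdiv', mul_zero] using hid

/-- Novack's (unforced) weak Euler solutions are weak Euler solutions on `(0, T)` in the
pressure-free sense `Torus.IsWeakEulerSolutionOn` of the tree (De Lellis–Székelyhidi 2009, §1). [cite: Novack2024, Sect. 1 p. 4 weak formulation preceding Thm. 1] -/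
theorem IsWeakEulerSolutionWithPressureOn.isWeakEulerSolutionOn
    (h : IsWeakEulerSolutionWithPressureOn T 0 u₀ u p) : FunctionSpaces.Torus.IsWeakEulerSolutionOn T u :=
  h.isDistributionalNSSolutionOn.isWeakNSSolutionOn

end WeakForm

section
variable {T : ℝ} {u : ℝ → UnitAddTorus d → EuclideanSpace ℝ d}

/-! ## The named facts: Novack 2024, Theorem 1 (`ν = 0`, `f = 0`) -/

/-- **Novack 2024, Thm. 1 (energy balance identities), Euler case, the 4/3 and 4/5 lines.** Let
`d ≥ 2` and let `(u, p)` be a weak solution of the `d`-dimensional incompressible Euler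
equations on `[0,T] × T^d` in the sense of `IsWeakEulerSolutionWithPressureOn T 0 u₀ u p` with
`u ∈ L³([0,T] × T^d) ∩ C⁰([0,T]; L²(T^d))`, `u₀ ∈ L²(T^d)` (and `p ∈ L^{3/2}`, the integrability
the printed proof uses). Then the balance `∂ₜ|u|² + ∂ⱼ(uʲ|u|² + 2puʲ) = −2D_•[u]` holds in the
sense of distributions with `D_I`, `D_L` **defined by** the shell limits
`−(4/d) D_I[u] = lim_{ℓ→0} ℓ⁻¹ ⨍_{S^{d−1}} y·δu |δu|²(ℓy) dy` and
`−(12/(d(d+2))) D_L[u] = lim_{ℓ→0} ℓ⁻¹ ⨍_{S^{d−1}} (y·δu(ℓy))³ dy` — in particular these limits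
**exist** (no conditionality, op. cit. §1). In the tree's vocabulary: for every functional `D`
satisfying the (halved) local energy balance `HasLocalEnergyBalance T 0 u p G D`, the local 4/3
law `HasFourThirdsLaw T u D` (constant `fourThirdsConst d = 4/d`) and the local 4/5 law
`HasFourFifthsLaw T u D` (constant `fourFifthsConst d = 12/(d(d+2))`) hold. [cite: Novack2024, Thm. 1] -/
def novack2024_fourThirds_fourFifths : Prop :=
  ∀ [DecidableEq d] {T : ℝ} {u₀ : UnitAddTorus d → EuclideanSpace ℝ d}
    {u : ℝ → UnitAddTorus d → EuclideanSpace ℝ d} {p : ℝ → UnitAddTorus d → ℝ},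
    2 ≤ Fintype.card d → 0 < T → IsWeakEulerSolutionWithPressureOn T 0 u₀ u p →
    ContinuousInLpOn (Icc 0 T) 2 u → (∫⁻ t in Ioo 0 T, ∫⁻ x, ‖u t x‖ₑ ^ (3 : ℕ) < ∞) →
    (∫⁻ t in Ioo 0 T, ∫⁻ x, ‖p t x‖ₑ ^ (3 / 2 : ℝ) < ∞) → MemLp u₀ 2 volume →
    ∀ {G : ℝ → UnitAddTorus d → EuclideanSpace ℝ d →L[ℝ] EuclideanSpace ℝ d} {D : STFunctional d},
      HasLocalEnergyBalance T 0 u p G D → HasFourThirdsLaw T u D ∧ HasFourFifthsLaw T u D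

/-- **Novack 2024, Thm. 1, Euler case, the transverse (`8/15`-type) line.** Under the same
hypotheses, the balance holds with `D_T` **defined by**
`−(4(d−1)/(d(d+2))) D_T[u] = lim_{ℓ→0} ℓ⁻¹ ⨍_{S^{d−1}} y·δu |T_T(y) δu|²(ℓy) dy`,
`T_T(y) δu = δu − (y·δu) y` (the limit exists); i.e. for every `D` with the local energy balance
and every test function `ψ` supported in `(0,T) × T^d`,
`∫₀ᵀ∫ ℓ⁻¹ ⨍ (δu·ω) |δu − (δu·ω)ω|²(ℓω) dω ψ → −(4(d−1)/(d(d+2))) D ψ` as `ℓ → 0⁺`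
(`= −(8/15) D ψ` for `d = 3`, Remark 1 "Numerology"; the sphere average is the accepted
`Torus.mixedFluxSphereAvg`). [cite: Novack2024, Thm. 1] -/
def novack2024_transverseLaw : Prop :=
  ∀ [DecidableEq d] {T : ℝ} {u₀ : UnitAddTorus d → EuclideanSpace ℝ d}
    {u : ℝ → UnitAddTorus d → EuclideanSpace ℝ d} {p : ℝ → UnitAddTorus d → ℝ},
    2 ≤ Fintype.card d → 0 < T → IsWeakEulerSolutionWithPressureOn T 0 u₀ u p →
    ContinuousInLpOn (Icc 0 T) 2 u → (∫⁻ t in Ioo 0 T, ∫⁻ x, ‖u t x‖ₑ ^ (3 : ℕ) < ∞) →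
    (∫⁻ t in Ioo 0 T, ∫⁻ x, ‖p t x‖ₑ ^ (3 / 2 : ℝ) < ∞) → MemLp u₀ 2 volume →
    ∀ {G : ℝ → UnitAddTorus d → EuclideanSpace ℝ d →L[ℝ] EuclideanSpace ℝ d} {D : STFunctional d},
      HasLocalEnergyBalance T 0 u p G D →
      ∀ {ψ : ℝ → UnitAddTorus d → ℝ}, FunctionSpaces.Torus.IsSpaceTimeTestIoo T ψ →
        Tendsto (fun ℓ => ∫ t in Ioo 0 T, ∫ x, ℓ⁻¹ * mixedFluxSphereAvg (u t) ℓ x * ψ t x)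
          (𝓝[>] 0)
          (𝓝 (-(4 * ((Fintype.card d : ℝ) - 1) /
            ((Fintype.card d : ℝ) * ((Fintype.card d : ℝ) + 2))) * D ψ))

/-- Numerology check (Novack 2024, Remark 1): in three dimensions the transverse constant
`4(d−1)/(d(d+2))` is `8/15`, the constant of Eyink's `S_T(u) = −(8/15) D(u)`. [cite: Novack2024, Remark 1] -/
theorem transverseConst_fin_three :
    (4 * ((Fintype.card (Fin 3) : ℝ) - 1) /
      ((Fintype.card (Fin 3) : ℝ) * ((Fintype.card (Fin 3) : ℝ) + 2))) = 8 / 15 := by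
  norm_num [Fintype.card_fin]

/-! ## Transfer of the laws between functionals agreeing on test functions -/

/-- The local 4/5 law only sees `D` through its values on test functions supported in
`(0,T) × T^d`. [folklore] -/
theorem HasFourFifthsLaw.congr {D D' : STFunctional d} (h : HasFourFifthsLaw T u D)
    (hDD' : ∀ ψ : ℝ → UnitAddTorus d → ℝ, FunctionSpaces.Torus.IsSpaceTimeTestIoo T ψ → D ψ = D' ψ) :
    HasFourFifthsLaw T u D' := by
  intro ψ hψ
  rw [← hDD' ψ hψ]
  exact h ψ hψ

/-- The local 4/3 law only sees `D` through its values on test functions supported in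
`(0,T) × T^d`. [folklore] -/
theorem HasFourThirdsLaw.congr {D D' : STFunctional d} (h : HasFourThirdsLaw T u D)
    (hDD' : ∀ ψ : ℝ → UnitAddTorus d → ℝ, FunctionSpaces.Torus.IsSpaceTimeTestIoo T ψ → D ψ = D' ψ) :
    HasFourThirdsLaw T u D' := by
  intro ψ hψ
  rw [← hDD' ψ hψ]
  exact h ψ hψ

end

/-! ## The corrected statements: unconditional laws for Duchon–Robert defects -/

section Corrected

variable [DecidableEq d] {T : ℝ} {f u : ℝ → UnitAddTorus d → EuclideanSpace ℝ d}
  {u₀ : UnitAddTorus d → EuclideanSpace ℝ d} {p : ℝ → UnitAddTorus d → ℝ}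

/-- The guarded mixed classes `L³_t L³_x`, `L^{3/2}_t L^{3/2}_x` consumed by Duchon–Robert's
Prop. 2 from the joint `L³` / `L^{3/2}` bounds of a Novack weak solution (Tonelli). [folklore] -/
theorem IsWeakEulerSolutionWithPressureOn.memLqLp (hsol : IsWeakEulerSolutionWithPressureOn T f u₀ u p)
    (hu3 : ∫⁻ t in Ioo 0 T, ∫⁻ x, ‖u t x‖ₑ ^ (3 : ℕ) < ∞)
    (hp : ∫⁻ t in Ioo 0 T, ∫⁻ x, ‖p t x‖ₑ ^ (3 / 2 : ℝ) < ∞) :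
    MemLqLp 3 3 u (Ioo 0 T) ∧ MemLqLp (3 / 2) (3 / 2) p (Ioo 0 T) := by
  constructor
  · refine memLqLp_of_lintegral_lt_top three_ne_zero ENNReal.ofNat_ne_top
      (aestronglyMeasurable_uncurry_prod hsol.1) ?_
    have h3 : ∀ x : ℝ≥0∞, x ^ (3 : ℝ≥0∞).toReal = x ^ (3 : ℕ) := fun x => by
      rw [ENNReal.toReal_ofNat, ← ENNReal.rpow_natCast]; norm_num
    simpa only [h3] using hu3
  · refine memLqLp_of_lintegral_lt_top (by norm_num) (ENNReal.div_ne_top ENNReal.ofNat_ne_top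
      (by norm_num)) (aestronglyMeasurable_uncurry_prod hsol.2.2.1) ?_
    have h32 : ((3 / 2 : ℝ≥0∞)).toReal = (3 / 2 : ℝ) := by
      rw [ENNReal.toReal_div, ENNReal.toReal_ofNat, ENNReal.toReal_ofNat]
    simpa only [h32] using hp

/-- **Any Duchon–Robert defect satisfies the local energy balance of a Novack weak solution**
(Duchon–Robert 2000, Prop. 2, threaded as the named fact `FluidPDE.duchon_robert_defect_exists`):
Prop. 2 produces *a* defect `D(u)` with the balance, and two Duchon–Robert defects of the same
field agree on test functions (`HasDuchonRobertDefect.unique`), so the balance transfers to the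
given `D`. For `ν = 0` the gradient witness is irrelevant, whence any `G`. [cite: DuchonRobert2000, Prop. 2] -/
theorem HasDuchonRobertDefect.hasLocalEnergyBalance_of_novackWeak
    (hP2 : FluidPDE.duchon_robert_defect_exists (T := T) (ν := 0) (u := u) (p := p))
    (hT : 0 ≤ T) (hsol : IsWeakEulerSolutionWithPressureOn T 0 u₀ u p)
    (hu3 : ∫⁻ t in Ioo 0 T, ∫⁻ x, ‖u t x‖ₑ ^ (3 : ℕ) < ∞)
    (hp : ∫⁻ t in Ioo 0 T, ∫⁻ x, ‖p t x‖ₑ ^ (3 / 2 : ℝ) < ∞)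
    {D : STFunctional d} (h : HasDuchonRobertDefect T u D)
    (G : ℝ → UnitAddTorus d → EuclideanSpace ℝ d →L[ℝ] EuclideanSpace ℝ d) :
    HasLocalEnergyBalance T 0 u p G D := by
  obtain ⟨hu3', hp'⟩ := hsol.memLqLp hu3 hp
  obtain ⟨D₁, hD₁, G₁, -, hbal⟩ :=
    hP2 hT le_rfl hsol.isDistributionalNSSolutionOn hu3' hp' (fun h0 => (h0 rfl).elim)
  refine ⟨fun h0 => (h0 rfl).elim, fun ψ hψ => ?_⟩
  have hb := hbal.2 ψ hψ
  rw [hD₁.unique h hψ] at hb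
  simpa only [zero_mul, sub_zero] using hb

/-- **The local 4/5 law, corrected form of `HasDuchonRobertDefect.hasFourFifthsLaw`** (Novack
2024, Thm. 1 with Duchon–Robert 2000, Prop. 2). Granted the two named facts
`novack2024_fourThirds_fourFifths` (Novack's Thm. 1) and `FluidPDE.duchon_robert_defect_exists`
(DR Prop. 2): in dimension `d ≥ 2`, if `(u, p)` is a weak Euler solution on `[0,T] × T^d` in
Novack's sense with `u ∈ L³ ∩ C⁰([0,T]; L²)`, `p ∈ L^{3/2}`, `u₀ ∈ L²`, then **every**
Duchon–Robert defect `D` of `u` satisfies the local 4/5 law `HasFourFifthsLaw T u D` — the shell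
limit `lim_{ℓ→0⁺} ℓ⁻¹ ⨍ (δ_L u(ℓω))³ dω` exists and equals `−(12/(d(d+2))) D`.
**Discrepancy record:** the accepted `HasDuchonRobertDefect.hasFourFifthsLaw` (cited to Eyink
2003, who assumes the limit exists) states this for all `L³` weak Euler solutions in all
dimensions; the published unconditional theorem carries the extra standing hypothesis
`u ∈ C⁰_t L²_x` (and `d ≥ 2`). [cite: Novack2024, Thm. 1] -/
theorem HasDuchonRobertDefect.hasFourFifthsLaw_of_continuousInLp
    (hN : novack2024_fourThirds_fourFifths (d := d))
    (hP2 : FluidPDE.duchon_robert_defect_exists (T := T) (ν := 0) (u := u) (p := p))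
    (hd : 2 ≤ Fintype.card d) (hT : 0 < T) (hsol : IsWeakEulerSolutionWithPressureOn T 0 u₀ u p)
    (hC : ContinuousInLpOn (Icc 0 T) 2 u) (hu3 : ∫⁻ t in Ioo 0 T, ∫⁻ x, ‖u t x‖ₑ ^ (3 : ℕ) < ∞)
    (hp : ∫⁻ t in Ioo 0 T, ∫⁻ x, ‖p t x‖ₑ ^ (3 / 2 : ℝ) < ∞) (hu₀ : MemLp u₀ 2 volume)
    {D : STFunctional d} (h : HasDuchonRobertDefect T u D) : HasFourFifthsLaw T u D :=
  (hN hd hT hsol hC hu3 hp hu₀ (h.hasLocalEnergyBalance_of_novackWeak hP2 hT.le hsol hu3 hp 0)).2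

/-- **The local 4/3 law, corrected form of `HasDuchonRobertDefect.hasFourThirdsLaw`** (Novack
2024, Thm. 1 with Duchon–Robert 2000, Prop. 2): under the hypotheses of
`hasFourFifthsLaw_of_continuousInLp`, every Duchon–Robert defect `D` of `u` satisfies
`HasFourThirdsLaw T u D` — the shell limit `lim_{ℓ→0⁺} ℓ⁻¹ ⨍ δ_L u |δu|²(ℓω) dω` exists and
equals `−(4/d) D`. Same discrepancy record as for the 4/5 law. [cite: Novack2024, Thm. 1] -/
theorem HasDuchonRobertDefect.hasFourThirdsLaw_of_continuousInLp
    (hN : novack2024_fourThirds_fourFifths (d := d))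
    (hP2 : FluidPDE.duchon_robert_defect_exists (T := T) (ν := 0) (u := u) (p := p))
    (hd : 2 ≤ Fintype.card d) (hT : 0 < T) (hsol : IsWeakEulerSolutionWithPressureOn T 0 u₀ u p)
    (hC : ContinuousInLpOn (Icc 0 T) 2 u) (hu3 : ∫⁻ t in Ioo 0 T, ∫⁻ x, ‖u t x‖ₑ ^ (3 : ℕ) < ∞)
    (hp : ∫⁻ t in Ioo 0 T, ∫⁻ x, ‖p t x‖ₑ ^ (3 / 2 : ℝ) < ∞) (hu₀ : MemLp u₀ 2 volume)
    {D : STFunctional d} (h : HasDuchonRobertDefect T u D) : HasFourThirdsLaw T u D :=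
  (hN hd hT hsol hC hu3 hp hu₀ (h.hasLocalEnergyBalance_of_novackWeak hP2 hT.le hsol hu3 hp 0)).1

/-- **The transverse (`8/15`-type) law for Duchon–Robert defects** (Novack 2024, Thm. 1, line
`• = T`, with Duchon–Robert 2000, Prop. 2): under the hypotheses of
`hasFourFifthsLaw_of_continuousInLp` and granted `novack2024_transverseLaw`, for every
Duchon–Robert defect `D` of `u` and every test function `ψ` supported in `(0,T) × T^d`,
`∫₀ᵀ∫ ℓ⁻¹ ⨍ δ_L u |δu_T|²(ℓω) dω ψ → −(4(d−1)/(d(d+2))) D ψ` as `ℓ → 0⁺`. [cite: Novack2024, Thm. 1] -/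
theorem HasDuchonRobertDefect.tendsto_mixedFlux_of_continuousInLp
    (hN : novack2024_transverseLaw (d := d))
    (hP2 : FluidPDE.duchon_robert_defect_exists (T := T) (ν := 0) (u := u) (p := p))
    (hd : 2 ≤ Fintype.card d) (hT : 0 < T) (hsol : IsWeakEulerSolutionWithPressureOn T 0 u₀ u p)
    (hC : ContinuousInLpOn (Icc 0 T) 2 u) (hu3 : ∫⁻ t in Ioo 0 T, ∫⁻ x, ‖u t x‖ₑ ^ (3 : ℕ) < ∞)
    (hp : ∫⁻ t in Ioo 0 T, ∫⁻ x, ‖p t x‖ₑ ^ (3 / 2 : ℝ) < ∞) (hu₀ : MemLp u₀ 2 volume)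
    {D : STFunctional d} (h : HasDuchonRobertDefect T u D)
    {ψ : ℝ → UnitAddTorus d → ℝ} (hψ : FunctionSpaces.Torus.IsSpaceTimeTestIoo T ψ) :
    Tendsto (fun ℓ => ∫ t in Ioo 0 T, ∫ x, ℓ⁻¹ * mixedFluxSphereAvg (u t) ℓ x * ψ t x) (𝓝[>] 0)
      (𝓝 (-(4 * ((Fintype.card d : ℝ) - 1) /
        ((Fintype.card d : ℝ) * ((Fintype.card d : ℝ) + 2))) * D ψ)) :=
  hN hd hT hsol hC hu3 hp hu₀ (h.hasLocalEnergyBalance_of_novackWeak hP2 hT.le hsol hu3 hp 0) hψ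

end Corrected

end Literature.Analysis.FluidPDE.Torus
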